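import Mathlib.Analysis.SpecialFunctions.Pow.Continuity
import Mathlib.Analysis.SpecialFunctions.Pow.Real
import Mathlib.Analysis.SpecialFunctions.Log.Basic
import Mathlib.Analysis.SpecificLimits.Basic
import Mathlib.Order.LiminfLimsup
import Mathlib.Topology.Algebra.Order.LiminfLimsup
import HarnessLib
import Summits.AtomisticToContinuum.HydrodynamicLimit.Theorems.CollisionIsometryCLTMacroClosureFvMixingParamsA

/-!
# Sub-goal `tl_chain` of the lead's thermodynamic-limit step (line `IdeatorTwoGen1Sketch`,
# crux `MacroClosure`, stmt-AtomisticToContinuum-14870)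

Support file (`--supports stmt-AtomisticToContinuum-14870`) for the registered sub-goal
`Barycentric.tl_chain`: the ABSTRACT Fekete-type chain argument behind the existence of the
thermodynamic limit of Ruelle's box free volume.  Pure real analysis of a doubly indexed family
`b m η` (`m` particles, density `η`): if `b` is bounded (P0), monotone in the density (P4),
nearly subadditive along the chains `m ↦ k³ m` at fixed density (P1) and satisfies the
particle-removal inequality `n b(n, η n / n') ≤ n' b(n', η)` (P2), then for `η' < η` the `limsup`
of `m ↦ b m η'` is at most the `liminf` of `m ↦ b m η`.

Proof (ε / chain argument).  Fix `ε > 0` and let `L = liminf_m b m η`.  Pick an anchor `M₀` with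
`b M₀ η < L + ε` and `(1 + log M₀ / 2) / M₀ ≤ ε` (the defect tends to zero and `b · η < L + ε`
frequently).  By (P1), `b (k³ M₀) η ≤ L + 2ε` for every `k ≥ 1`.  For `n ≥ M₀` put
`k = ⌈(n / M₀)^{1/3}⌉₊`, `N = k³ M₀`, so that `n ≤ N ≤ (1 + (M₀ / n)^{1/3})³ n`; (P2) with `(n, N)`
and (P4) give `b n η' ≤ b n (η n / N) ≤ (N / n) (L + 2ε)`, and the factor `(1 + (M₀/n)^{1/3})³`
tends to one.  Helpers live in the namespace `Barycentric.TlChain` (the identity `(x^{1/3})³ = x` is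
`FvMixingParams.rpow_third_pow_three` of the wave-3 helpers):

* `tendsto_defect` — `(1 + log m / 2) / m → 0`;
* `tendsto_factor` — `(1 + (M₀ / n)^{1/3})³ → 1`;
* `step` — the chain estimate for one `n`.
-/

noncomputable section

open Filter Set Topology

namespace Summit.AtomisticToContinuum.HydrodynamicLimit.Theorems.MacroClosureLine

namespace Barycentric

namespace TlChain

/-- The subadditivity defect `(1 + log m / 2) / m` tends to zero. -/
theorem tendsto_defect :
    Tendsto (fun m : ℕ => (1 + Real.log m / 2) / (m : ℝ)) atTop (𝓝 0) := by
  have h1 : Tendsto (fun m : ℕ => (1 : ℝ) / m) atTop (𝓝 0) :=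
    tendsto_const_div_atTop_nhds_zero_nat 1
  have h2 : Tendsto (fun x : ℝ => Real.log x ^ 1 / (1 * x + 0)) atTop (𝓝 0) :=
    Real.tendsto_pow_log_div_mul_add_atTop 1 0 1 one_ne_zero
  have h3 : Tendsto (fun m : ℕ => Real.log m / m) atTop (𝓝 0) := by
    refine (h2.comp tendsto_natCast_atTop_atTop).congr fun m => ?_
    simp
  have h4 := h1.add (h3.div_const 2)
  rw [zero_div, add_zero] at h4
  refine h4.congr fun m => ?_
  ring

/-- The overshoot factor `(1 + (M₀ / n)^{1/3})³` tends to one. -/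
theorem tendsto_factor (M₀ : ℕ) :
    Tendsto (fun n : ℕ => (1 + ((M₀ : ℝ) / n) ^ (1 / 3 : ℝ)) ^ 3) atTop (𝓝 1) := by
  have h1 : Tendsto (fun n : ℕ => ((M₀ : ℝ) / n)) atTop (𝓝 0) :=
    tendsto_const_div_atTop_nhds_zero_nat _
  have h2 : Tendsto (fun n : ℕ => ((M₀ : ℝ) / n) ^ (1 / 3 : ℝ)) atTop (𝓝 0) :=
    h1.rpow_const_nhds_zero (by norm_num)
  have h3 := (h2.const_add 1).pow 3
  rw [add_zero, one_pow] at h3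
  exact h3

/-- The chain estimate for one `n ≥ M₀`: with `k = ⌈(n / M₀)^{1/3}⌉₊` and `N = k³ M₀` one has
`n ≤ N ≤ (1 + (M₀ / n)^{1/3})³ n`, so particle removal (P2) with `(n, N)`, the chain bound
`b N η ≤ A` and monotonicity in the density (P4) give
`b n η' ≤ b n (η n / N) ≤ (1 + (M₀ / n)^{1/3})³ A`. -/
theorem step (b : ℕ → ℝ → ℝ) (ηmax η η' A : ℝ) (m₀ M₀ n : ℕ) (hm₀ : 1 ≤ m₀)
    (hP4 : ∀ m, m₀ ≤ m → ∀ η η', 0 ≤ η → η ≤ η' → η' ≤ ηmax → b m η ≤ b m η')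
    (hP2 : ∀ n n', m₀ ≤ n → n ≤ n' → ∀ η, 0 ≤ η → η ≤ ηmax →
      (n : ℝ) * b n (η * n / n') ≤ n' * b n' η)
    (hA : 0 ≤ A) (hchain : ∀ k, 1 ≤ k → b (k ^ 3 * M₀) η ≤ A)
    (hη' : 0 ≤ η') (hη'η : η' < η) (hη : η ≤ ηmax) (hM₀ : m₀ ≤ M₀) (hn : M₀ ≤ n)
    (hF : (1 + ((M₀ : ℝ) / n) ^ (1 / 3 : ℝ)) ^ 3 * η' ≤ η) :
    b n η' ≤ (1 + ((M₀ : ℝ) / n) ^ (1 / 3 : ℝ)) ^ 3 * A := by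
  have hη0 : 0 ≤ η := hη'.trans hη'η.le
  have hM₀pos : (0 : ℝ) < M₀ := by exact_mod_cast hm₀.trans hM₀
  have hn0 : (0 : ℝ) < n := by exact_mod_cast hm₀.trans (hM₀.trans hn)
  set r : ℝ := ((n : ℝ) / M₀) ^ (1 / 3 : ℝ) with hr
  set s : ℝ := ((M₀ : ℝ) / n) ^ (1 / 3 : ℝ) with hs
  have hr0 : 0 < r := Real.rpow_pos_of_pos (div_pos hn0 hM₀pos) _
  have hs0 : 0 ≤ s := Real.rpow_nonneg (div_nonneg hM₀pos.le hn0.le) _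
  have hrs : r * s = 1 := by
    rw [hr, hs, ← Real.mul_rpow (div_nonneg hn0.le hM₀pos.le) (div_nonneg hM₀pos.le hn0.le),
      div_mul_div_cancel₀ hM₀pos.ne', div_self hn0.ne', Real.one_rpow]
  have hr3 : r ^ 3 = n / M₀ :=
    FvMixingParams.rpow_third_pow_three _ (div_nonneg hn0.le hM₀pos.le)
  have hnr : (n : ℝ) = r ^ 3 * M₀ := by rw [hr3]; field_simp
  set k : ℕ := ⌈r⌉₊ with hk
  have hk1 : 1 ≤ k := Nat.one_le_ceil_iff.2 hr0
  have hrk : r ≤ k := Nat.le_ceil r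
  have hkr : (k : ℝ) ≤ r + 1 := (Nat.ceil_lt_add_one hr0.le).le
  set N : ℕ := k ^ 3 * M₀ with hN
  have hNcast : (N : ℝ) = (k : ℝ) ^ 3 * M₀ := by rw [hN]; push_cast; ring
  -- `n ≤ N`
  have hnN_real : (n : ℝ) ≤ N := by
    rw [hnr, hNcast]
    gcongr
  have hnN : n ≤ N := by exact_mod_cast hnN_real
  have hNpos : (0 : ℝ) < N := lt_of_lt_of_le hn0 hnN_real
  -- `N ≤ (1 + s)³ n`
  have hNF : (N : ℝ) ≤ (1 + s) ^ 3 * n := by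
    have h2 : (1 + s) ^ 3 * n = (r + 1) ^ 3 * M₀ := by
      have : r + 1 = r * (1 + s) := by rw [mul_add, mul_one, hrs]
      rw [this, mul_pow, hnr]
      ring
    rw [hNcast, h2]
    gcongr
  -- particle removal (P2) with `(n, N)` and the chain bound
  have hbN : b N η ≤ A := hchain k hk1
  have h3 : (n : ℝ) * b n (η * n / N) ≤ n * ((1 + s) ^ 3 * A) :=
    calc (n : ℝ) * b n (η * n / N) ≤ N * b N η := hP2 n N (hM₀.trans hn) hnN η hη0 hη
      _ ≤ N * A := by gcongr
      _ ≤ (1 + s) ^ 3 * n * A := by gcongr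
      _ = n * ((1 + s) ^ 3 * A) := by ring
  have h4 : b n (η * n / N) ≤ (1 + s) ^ 3 * A := le_of_mul_le_mul_left h3 hn0
  -- monotonicity in the density (P4)
  have h5 : η' ≤ η * n / N := by
    rw [le_div_iff₀ hNpos]
    calc η' * N ≤ η' * ((1 + s) ^ 3 * n) := by gcongr
      _ = (1 + s) ^ 3 * η' * n := by ring
      _ ≤ η * n := by gcongr
  have h6 : η * n / N ≤ ηmax := by
    rw [div_le_iff₀ hNpos]
    calc η * n ≤ η * N := by gcongr
      _ ≤ ηmax * N := by gcongr
  exact (hP4 n (hM₀.trans hn) η' (η * n / N) hη' h5 h6).trans h4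

end TlChain

/-- **Sub-goal `tl_chain`** (registered signature): the abstract Fekete-type chain argument.
For a family `b m η` which, for `m ≥ m₀` and densities in `[0, ηmax]`, is bounded (P0),
monotone in the density (P4), nearly subadditive along the chains `m ↦ k³ m` at fixed density
(P1) and satisfies the particle-removal inequality (P2), the `limsup` of `m ↦ b m η'` at a
smaller density `η' < η` is at most the `liminf` of `m ↦ b m η`. -/
theorem tl_chain : ∀ (b : ℕ → ℝ → ℝ) (C ηmax : ℝ) (m₀ : ℕ), 1 ≤ m₀ → 0 < ηmax →
    (∀ m, m₀ ≤ m → ∀ η, 0 ≤ η → η ≤ ηmax → 0 ≤ b m η ∧ b m η ≤ C) →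
    (∀ m, m₀ ≤ m → ∀ η η', 0 ≤ η → η ≤ η' → η' ≤ ηmax → b m η ≤ b m η') →
    (∀ k m, 1 ≤ k → m₀ ≤ m → ∀ η, 0 ≤ η → η ≤ ηmax →
      b (k ^ 3 * m) η ≤ b m η + (1 + Real.log m / 2) / m) →
    (∀ n n', m₀ ≤ n → n ≤ n' → ∀ η, 0 ≤ η → η ≤ ηmax →
      (n : ℝ) * b n (η * n / n') ≤ n' * b n' η) →
    ∀ η η', 0 ≤ η' → η' < η → η ≤ ηmax →
      limsup (fun m => b m η') atTop ≤ liminf (fun m => b m η) atTop := by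
  intro b C ηmax m₀ hm₀ _hηmax hP0 hP4 hP1 hP2 η η' hη' hη'η hηmax
  have hη0 : 0 ≤ η := hη'.trans hη'η.le
  have hη'max : η' ≤ ηmax := hη'η.le.trans hηmax
  -- eventual bounds from (P0)
  have hEη : ∀ᶠ m in atTop, 0 ≤ b m η ∧ b m η ≤ C :=
    (eventually_ge_atTop m₀).mono fun m hm => hP0 m hm η hη0 hηmax
  have hEη' : ∀ᶠ m in atTop, 0 ≤ b m η' ∧ b m η' ≤ C :=
    (eventually_ge_atTop m₀).mono fun m hm => hP0 m hm η' hη' hη'max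
  have hbdd1 : IsBoundedUnder (· ≤ ·) atTop (fun m => b m η) :=
    isBoundedUnder_of_eventually_le (hEη.mono fun m hm => hm.2)
  have hbdd3 : IsBoundedUnder (· ≥ ·) atTop (fun m => b m η') :=
    isBoundedUnder_of_eventually_ge (hEη'.mono fun m hm => hm.1)
  set L := liminf (fun m => b m η) atTop with hL
  have hL0 : 0 ≤ L :=
    le_liminf_of_le hbdd1.isCoboundedUnder_ge (hEη.mono fun m hm => hm.1)
  refine le_of_forall_pos_le_add fun δ hδ => ?_
  set ε := δ / 3 with hε
  have hε0 : 0 < ε := by positivity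
  -- (i) the anchor `M₀`
  have hfreq : ∃ᶠ m in atTop, b m η < L + ε :=
    frequently_lt_of_liminf_lt hbdd1.isCoboundedUnder_ge (by linarith)
  have hdecay : ∀ᶠ m : ℕ in atTop, (1 + Real.log m / 2) / (m : ℝ) ≤ ε :=
    (TlChain.tendsto_defect.eventually_lt_const hε0).mono fun m hm => hm.le
  obtain ⟨M₀, hM₀lt, hM₀m, hM₀d⟩ :=
    (hfreq.and_eventually ((eventually_ge_atTop m₀).and hdecay)).exists
  -- (ii) the chain bound along `k ↦ k³ M₀`
  have hchain : ∀ k, 1 ≤ k → b (k ^ 3 * M₀) η ≤ L + 2 * ε := by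
    intro k hk
    have := hP1 k M₀ hk hM₀m η hη0 hηmax
    linarith
  have hA : 0 ≤ L + 2 * ε := by positivity
  -- (iii)-(vi) the estimate for all large `n`
  have hF := TlChain.tendsto_factor M₀
  have hev1 : ∀ᶠ n : ℕ in atTop, (1 + ((M₀ : ℝ) / n) ^ (1 / 3 : ℝ)) ^ 3 * η' < η := by
    have := hF.mul_const η'
    rw [one_mul] at this
    exact this.eventually_lt_const hη'η
  have hev2 : ∀ᶠ n : ℕ in atTop,
      (1 + ((M₀ : ℝ) / n) ^ (1 / 3 : ℝ)) ^ 3 * (L + 2 * ε) < L + 3 * ε := by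
    have := hF.mul_const (L + 2 * ε)
    rw [one_mul] at this
    exact this.eventually_lt_const (by linarith)
  have hev : ∀ᶠ n : ℕ in atTop, b n η' ≤ L + 3 * ε := by
    filter_upwards [hev1, hev2, eventually_ge_atTop M₀] with n h1 h2 h3
    have := TlChain.step b ηmax η η' (L + 2 * ε) m₀ M₀ n hm₀ hP4 hP2 hA hchain hη' hη'η hηmax
      hM₀m h3 h1.le
    linarith
  calc limsup (fun m => b m η') atTop ≤ L + 3 * ε := limsup_le_of_le hbdd3.isCoboundedUnder_le hev
    _ = L + δ := by rw [hε]; ring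

end Barycentric

end Summit.AtomisticToContinuum.HydrodynamicLimit.Theorems.MacroClosureLine
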